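import Summits.HubbardSuperconductivity.HubbardSuperconductivity.Theorems.AnisotropyChordSpinMonotoneTwoMagnonRookHopping

/-!
# Route `AnisotropyChord`: THEOREM R wrapper — weighted hop sums on the rook graph `K_m □ K_n`

Rook graph on `α × β` with DIRECTION WEIGHTS: a bond weight `w : Sym2 (α × β) → ℂ` equal to `ω₁` on
row bonds (`x.1 ≠ y.1`, `x.2 = y.2`) and `ω₂` on column bonds (`x.1 = y.1`, `x.2 ≠ y.2`).  For a
class-constant pair function `f` (values `A`, `B`, `C` on row, column and far pairs) the weighted
"one endpoint moves" sums of the pair equation `Weighted.xxzWith_mulVec_pair` are computed: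
`whopSum_eq_two_mul` (any graph: reduction to the two weighted neighbour sums), `wrook_sum_adj`
(row moves carry `ω₁`, column moves `ω₂`), and the six class sums
`rowPair_whopSum(')  = ω₁(|α|−2)A + ω₂(|β|−1)C`, `colPair_whopSum(') = ω₂(|β|−2)B + ω₁(|α|−1)C`,
`farPair_whopSum(') = ω₁(B + (|α|−2)C) + ω₂(A + (|β|−2)C)`.  For `ω₁ = ω₂ = 1` these are the sums of
`…TwoMagnonRookHopping`.  Counting only; no definition is introduced.
-/

set_option linter.dupNamespace false

noncomputable section

namespace Summit.HubbardSuperconductivity.HubbardSuperconductivity.Theorems.AnisotropyChord.TwoMagnon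

open Matrix Complex Finset

/-! ### The weighted "one endpoint moves" double sum (any graph) -/

/-- The weighted "exactly one endpoint moves" double sum of `xxzWith_mulVec_pair`, reduced by
symmetry to the two weighted neighbour sums at `i` and at `j` (any finite graph, any bond weight).
[folklore] -/
theorem whopSum_eq_two_mul {V : Type*} [Fintype V] [DecidableEq V] (G : SimpleGraph V)
    [DecidableRel G.Adj] (w : Sym2 V → ℂ) (f : (V → Fin 2) → ℂ) {i j : V} (hij : i ≠ j) :
    (∑ x, ∑ y, (if G.Adj x y then
        (if ((x = i ∨ x = j) ∧ ¬ (y = i ∨ y = j) ∨ ¬ (x = i ∨ x = j) ∧ (y = i ∨ y = j)) then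
          w s(x, y) * f (Pi.single (Equiv.swap x y i) 1 + Pi.single (Equiv.swap x y j) 1) else 0)
        else 0)) =
      2 * ((∑ y, if y = i ∨ y = j then 0 else
              if G.Adj i y then w s(i, y) * f (Pi.single y 1 + Pi.single j 1) else 0)
           + (∑ y, if y = i ∨ y = j then 0 else
              if G.Adj j y then w s(j, y) * f (Pi.single i 1 + Pi.single y 1) else 0)) := by
  set F₁ : V → V → ℂ := fun x y => if (x = i ∨ x = j) ∧ ¬ (y = i ∨ y = j) then
      (if G.Adj x y then w s(x, y) * f (Pi.single (Equiv.swap x y i) 1 + Pi.single (Equiv.swap x y j) 1)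
        else 0)
    else 0 with hF₁
  have hsplit : ∀ x y, (if G.Adj x y then
        (if ((x = i ∨ x = j) ∧ ¬ (y = i ∨ y = j) ∨ ¬ (x = i ∨ x = j) ∧ (y = i ∨ y = j)) then
          w s(x, y) * f (Pi.single (Equiv.swap x y i) 1 + Pi.single (Equiv.swap x y j) 1) else 0)
        else 0)
      = F₁ x y + F₁ y x := by
    intro x y
    simp only [hF₁]
    rw [Equiv.swap_comm y x, Sym2.eq_swap (a := y)]
    by_cases hxy : G.Adj x y
    · have hyx : G.Adj y x := hxy.symm
      rw [if_pos hxy, if_pos hxy, if_pos hyx]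
      by_cases hx : (x = i ∨ x = j)
      · by_cases hy : (y = i ∨ y = j)
        · simp [hx, hy]
        · simp [hx, hy]
      · by_cases hy : (y = i ∨ y = j)
        · simp [hx, hy]
        · simp [hx, hy]
    · have hyx : ¬ G.Adj y x := fun h => hxy h.symm
      rw [if_neg hxy, if_neg hxy, if_neg hyx]
      simp
  simp_rw [hsplit]
  rw [Finset.sum_congr rfl fun x _ => Finset.sum_add_distrib (s := Finset.univ)
      (f := fun y => F₁ x y) (g := fun y => F₁ y x), Finset.sum_add_distrib,
    Finset.sum_comm (f := fun x y => F₁ y x), ← two_mul]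
  congr 1
  rw [Fintype.sum_eq_add i j hij]
  · congr 1
    · refine Finset.sum_congr rfl fun y _ => ?_
      simp only [hF₁, true_or, true_and]
      by_cases hy : (y = i ∨ y = j)
      · rw [if_neg (not_not_intro hy), if_pos hy]
      · rw [if_pos hy, if_neg hy]
        have hyi : y ≠ i := fun h => hy (Or.inl h)
        have hyj : y ≠ j := fun h => hy (Or.inr h)
        rw [Equiv.swap_apply_left, Equiv.swap_apply_of_ne_of_ne hij.symm hyj.symm]
    · refine Finset.sum_congr rfl fun y _ => ?_
      simp only [hF₁, or_true, true_and]
      by_cases hy : (y = i ∨ y = j)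
      · rw [if_neg (not_not_intro hy), if_pos hy]
      · rw [if_pos hy, if_neg hy]
        have hyi : y ≠ i := fun h => hy (Or.inl h)
        have hyj : y ≠ j := fun h => hy (Or.inr h)
        rw [Equiv.swap_apply_left, Equiv.swap_apply_of_ne_of_ne hij hyi.symm]
  · intro x hx
    refine Finset.sum_eq_zero fun y _ => ?_
    simp only [hF₁]
    rw [if_neg]
    push Not
    intro h
    exact absurd h (not_or.mpr hx)

/-! ### Weighted neighbour sums on the rook graph -/

variable {α β : Type*} [Fintype α] [DecidableEq α] [Fintype β] [DecidableEq β]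
variable {G : SimpleGraph (α × β)} [DecidableRel G.Adj] {w : Sym2 (α × β) → ℂ} {ω₁ ω₂ : ℂ}
variable {f : (α × β → Fin 2) → ℂ}

/-- **Weighted neighbour sum on the rook graph**: row moves carry `ω₁`, column moves `ω₂`.
[folklore] -/
theorem wrook_sum_adj
    (hadj : ∀ x y : α × β, G.Adj x y ↔ (x.1 ≠ y.1 ∧ x.2 = y.2) ∨ (x.1 = y.1 ∧ x.2 ≠ y.2))
    (hw₁ : ∀ x y : α × β, x.1 ≠ y.1 → x.2 = y.2 → w s(x, y) = ω₁)
    (hw₂ : ∀ x y : α × β, x.1 = y.1 → x.2 ≠ y.2 → w s(x, y) = ω₂)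
    (x : α × β) (g : α × β → ℂ) :
    (∑ y, if G.Adj x y then w s(x, y) * g y else 0) =
      ω₁ * (∑ a, if a = x.1 then 0 else g (a, x.2)) + ω₂ * ∑ b, if b = x.2 then 0 else g (x.1, b) := by
  rw [rook_sum_adj hadj x (fun y => w s(x, y) * g y), Finset.mul_sum, Finset.mul_sum]
  congr 1
  · refine Finset.sum_congr rfl fun a _ => ?_
    by_cases ha : a = x.1
    · rw [if_pos ha, if_pos ha, mul_zero]
    · rw [if_neg ha, if_neg ha, hw₁ x (a, x.2) (Ne.symm ha) rfl]
  · refine Finset.sum_congr rfl fun b _ => ?_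
    by_cases hb : b = x.2
    · rw [if_pos hb, if_pos hb, mul_zero]
    · rw [if_neg hb, if_neg hb, hw₂ x (x.1, b) rfl (Ne.symm hb)]

omit [Fintype α] [Fintype β] in
/-- Moving the exclusion `y ∉ {i, j}` inside the adjacency test (bookkeeping). [folklore] -/
theorem ite_or_ite_adj_comm (i j : α × β) (h : α × β → ℂ) (y : α × β) :
    (if y = i ∨ y = j then (0 : ℂ) else if G.Adj i y then w s(i, y) * h y else 0) =
      (if G.Adj i y then w s(i, y) * (if y = i ∨ y = j then 0 else h y) else 0) := by
  by_cases hy : (y = i ∨ y = j)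
  · simp [hy]
  · simp [hy]

/-- **Weighted neighbour sum at a row pair, `i`-side**: `ω₁(|α| − 2)·A + ω₂(|β| − 1)·C`.
[folklore] -/
theorem rowPair_whopSum
    (hadj : ∀ x y : α × β, G.Adj x y ↔ (x.1 ≠ y.1 ∧ x.2 = y.2) ∨ (x.1 = y.1 ∧ x.2 ≠ y.2))
    (hw₁ : ∀ x y : α × β, x.1 ≠ y.1 → x.2 = y.2 → w s(x, y) = ω₁)
    (hw₂ : ∀ x y : α × β, x.1 = y.1 → x.2 ≠ y.2 → w s(x, y) = ω₂)
    {A C : ℂ}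
    (hA : ∀ x y : α × β, x.1 ≠ y.1 → x.2 = y.2 → f (Pi.single x 1 + Pi.single y 1) = A)
    (hC : ∀ x y : α × β, x.1 ≠ y.1 → x.2 ≠ y.2 → f (Pi.single x 1 + Pi.single y 1) = C)
    {i j : α × β} (h1 : i.1 ≠ j.1) (h2 : i.2 = j.2) :
    (∑ y, if y = i ∨ y = j then 0 else
        if G.Adj i y then w s(i, y) * f (Pi.single y 1 + Pi.single j 1) else 0) =
      ω₁ * (((Fintype.card α : ℂ) - 2) * A) + ω₂ * (((Fintype.card β : ℂ) - 1) * C) := by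
  simp_rw [ite_or_ite_adj_comm i j (fun y => f (Pi.single y 1 + Pi.single j 1))]
  rw [wrook_sum_adj hadj hw₁ hw₂ i]
  congr 1
  · congr 1
    have h : ∀ a : α, (if a = i.1 then (0 : ℂ) else
        if ((a, i.2) = i ∨ (a, i.2) = j) then 0 else f (Pi.single (a, i.2) 1 + Pi.single j 1)) =
        if a = i.1 ∨ a = j.1 then 0 else A := by
      intro a
      by_cases ha : a = i.1
      · simp [ha]
      · by_cases ha' : a = j.1
        · subst ha'
          have : ((j.1, i.2) : α × β) = j := Prod.ext rfl h2
          simp [this]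
        · have hi : ((a, i.2) : α × β) ≠ i := fun h => ha (congrArg Prod.fst h)
          have hj : ((a, i.2) : α × β) ≠ j := fun h => ha' (congrArg Prod.fst h)
          rw [if_neg ha, if_neg (not_or.mpr ⟨hi, hj⟩), if_neg (not_or.mpr ⟨ha, ha'⟩)]
          exact hA _ _ ha' h2
    simp_rw [h]
    exact sum_ite_or_eq_else (fun h => h1 h) A
  · congr 1
    have h : ∀ b : β, (if b = i.2 then (0 : ℂ) else
        if ((i.1, b) = i ∨ (i.1, b) = j) then 0 else f (Pi.single (i.1, b) 1 + Pi.single j 1)) =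
        if b = i.2 then 0 else C := by
      intro b
      by_cases hb : b = i.2
      · simp [hb]
      · have hi : ((i.1, b) : α × β) ≠ i := fun h => hb (congrArg Prod.snd h)
        have hj : ((i.1, b) : α × β) ≠ j :=
          fun h => h1 (congrArg Prod.fst h : ((i.1, b) : α × β).1 = j.1)
        rw [if_neg hb, if_neg (not_or.mpr ⟨hi, hj⟩), if_neg hb]
        exact hC _ _ h1 (by rw [← h2]; exact hb)
    simp_rw [h]
    exact sum_ite_eq_else i.2 C

/-- **Weighted neighbour sum at a row pair, `j`-side**: the same value. [folklore] -/
theorem rowPair_whopSum'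
    (hadj : ∀ x y : α × β, G.Adj x y ↔ (x.1 ≠ y.1 ∧ x.2 = y.2) ∨ (x.1 = y.1 ∧ x.2 ≠ y.2))
    (hw₁ : ∀ x y : α × β, x.1 ≠ y.1 → x.2 = y.2 → w s(x, y) = ω₁)
    (hw₂ : ∀ x y : α × β, x.1 = y.1 → x.2 ≠ y.2 → w s(x, y) = ω₂)
    {A C : ℂ}
    (hA : ∀ x y : α × β, x.1 ≠ y.1 → x.2 = y.2 → f (Pi.single x 1 + Pi.single y 1) = A)
    (hC : ∀ x y : α × β, x.1 ≠ y.1 → x.2 ≠ y.2 → f (Pi.single x 1 + Pi.single y 1) = C)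
    {i j : α × β} (h1 : i.1 ≠ j.1) (h2 : i.2 = j.2) :
    (∑ y, if y = i ∨ y = j then 0 else
        if G.Adj j y then w s(j, y) * f (Pi.single i 1 + Pi.single y 1) else 0) =
      ω₁ * (((Fintype.card α : ℂ) - 2) * A) + ω₂ * (((Fintype.card β : ℂ) - 1) * C) := by
  have h := rowPair_whopSum (f := f) hadj hw₁ hw₂ (A := A) (C := C)
    (fun x y hx hy => by rw [pair_comm]; exact hA y x (Ne.symm hx) hy.symm)
    (fun x y hx hy => by rw [pair_comm]; exact hC y x (Ne.symm hx) (Ne.symm hy))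
    (i := j) (j := i) (Ne.symm h1) h2.symm
  rw [← h]
  refine Finset.sum_congr rfl fun y _ => ?_
  rw [pair_comm y i]
  by_cases hy : (y = i ∨ y = j)
  · rw [if_pos hy, if_pos hy.symm]
  · rw [if_neg hy, if_neg (show ¬ (y = j ∨ y = i) from fun h' => hy h'.symm)]

/-- **Weighted neighbour sum at a column pair, `i`-side**: `ω₂(|β| − 2)·B + ω₁(|α| − 1)·C`.
[folklore] -/
theorem colPair_whopSum
    (hadj : ∀ x y : α × β, G.Adj x y ↔ (x.1 ≠ y.1 ∧ x.2 = y.2) ∨ (x.1 = y.1 ∧ x.2 ≠ y.2))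
    (hw₁ : ∀ x y : α × β, x.1 ≠ y.1 → x.2 = y.2 → w s(x, y) = ω₁)
    (hw₂ : ∀ x y : α × β, x.1 = y.1 → x.2 ≠ y.2 → w s(x, y) = ω₂)
    {B C : ℂ}
    (hB : ∀ x y : α × β, x.1 = y.1 → x.2 ≠ y.2 → f (Pi.single x 1 + Pi.single y 1) = B)
    (hC : ∀ x y : α × β, x.1 ≠ y.1 → x.2 ≠ y.2 → f (Pi.single x 1 + Pi.single y 1) = C)
    {i j : α × β} (h1 : i.1 = j.1) (h2 : i.2 ≠ j.2) :
    (∑ y, if y = i ∨ y = j then 0 else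
        if G.Adj i y then w s(i, y) * f (Pi.single y 1 + Pi.single j 1) else 0) =
      ω₁ * (((Fintype.card α : ℂ) - 1) * C) + ω₂ * (((Fintype.card β : ℂ) - 2) * B) := by
  simp_rw [ite_or_ite_adj_comm i j (fun y => f (Pi.single y 1 + Pi.single j 1))]
  rw [wrook_sum_adj hadj hw₁ hw₂ i]
  congr 1
  · congr 1
    have h : ∀ a : α, (if a = i.1 then (0 : ℂ) else
        if ((a, i.2) = i ∨ (a, i.2) = j) then 0 else f (Pi.single (a, i.2) 1 + Pi.single j 1)) =
        if a = i.1 then 0 else C := by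
      intro a
      by_cases ha : a = i.1
      · simp [ha]
      · have hi : ((a, i.2) : α × β) ≠ i := fun h => ha (congrArg Prod.fst h)
        have hj : ((a, i.2) : α × β) ≠ j :=
          fun h => h2 (congrArg Prod.snd h : ((a, i.2) : α × β).2 = j.2)
        rw [if_neg ha, if_neg (not_or.mpr ⟨hi, hj⟩), if_neg ha]
        exact hC _ _ (by rw [← h1]; exact ha) h2
    simp_rw [h]
    exact sum_ite_eq_else i.1 C
  · congr 1
    have h : ∀ b : β, (if b = i.2 then (0 : ℂ) else
        if ((i.1, b) = i ∨ (i.1, b) = j) then 0 else f (Pi.single (i.1, b) 1 + Pi.single j 1)) =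
        if b = i.2 ∨ b = j.2 then 0 else B := by
      intro b
      by_cases hb : b = i.2
      · simp [hb]
      · by_cases hb' : b = j.2
        · subst hb'
          have : ((i.1, j.2) : α × β) = j := Prod.ext h1 rfl
          simp [this]
        · have hi : ((i.1, b) : α × β) ≠ i := fun h => hb (congrArg Prod.snd h)
          have hj : ((i.1, b) : α × β) ≠ j := fun h => hb' (congrArg Prod.snd h)
          rw [if_neg hb, if_neg (not_or.mpr ⟨hi, hj⟩), if_neg (not_or.mpr ⟨hb, hb'⟩)]
          exact hB _ _ h1 hb'
    simp_rw [h]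
    exact sum_ite_or_eq_else (fun h => h2 h) B

/-- **Weighted neighbour sum at a column pair, `j`-side**. [folklore] -/
theorem colPair_whopSum'
    (hadj : ∀ x y : α × β, G.Adj x y ↔ (x.1 ≠ y.1 ∧ x.2 = y.2) ∨ (x.1 = y.1 ∧ x.2 ≠ y.2))
    (hw₁ : ∀ x y : α × β, x.1 ≠ y.1 → x.2 = y.2 → w s(x, y) = ω₁)
    (hw₂ : ∀ x y : α × β, x.1 = y.1 → x.2 ≠ y.2 → w s(x, y) = ω₂)
    {B C : ℂ}
    (hB : ∀ x y : α × β, x.1 = y.1 → x.2 ≠ y.2 → f (Pi.single x 1 + Pi.single y 1) = B)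
    (hC : ∀ x y : α × β, x.1 ≠ y.1 → x.2 ≠ y.2 → f (Pi.single x 1 + Pi.single y 1) = C)
    {i j : α × β} (h1 : i.1 = j.1) (h2 : i.2 ≠ j.2) :
    (∑ y, if y = i ∨ y = j then 0 else
        if G.Adj j y then w s(j, y) * f (Pi.single i 1 + Pi.single y 1) else 0) =
      ω₁ * (((Fintype.card α : ℂ) - 1) * C) + ω₂ * (((Fintype.card β : ℂ) - 2) * B) := by
  have h := colPair_whopSum (f := f) hadj hw₁ hw₂ (B := B) (C := C)
    (fun x y hx hy => by rw [pair_comm]; exact hB y x hx.symm (Ne.symm hy))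
    (fun x y hx hy => by rw [pair_comm]; exact hC y x (Ne.symm hx) (Ne.symm hy))
    (i := j) (j := i) h1.symm (Ne.symm h2)
  rw [← h]
  refine Finset.sum_congr rfl fun y _ => ?_
  rw [pair_comm y i]
  by_cases hy : (y = i ∨ y = j)
  · rw [if_pos hy, if_pos hy.symm]
  · rw [if_neg hy, if_neg (show ¬ (y = j ∨ y = i) from fun h' => hy h'.symm)]

/-- **Weighted neighbour sum at a far pair, `i`-side**: `ω₁(B + (|α| − 2)C) + ω₂(A + (|β| − 2)C)`.
[folklore] -/
theorem farPair_whopSum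
    (hadj : ∀ x y : α × β, G.Adj x y ↔ (x.1 ≠ y.1 ∧ x.2 = y.2) ∨ (x.1 = y.1 ∧ x.2 ≠ y.2))
    (hw₁ : ∀ x y : α × β, x.1 ≠ y.1 → x.2 = y.2 → w s(x, y) = ω₁)
    (hw₂ : ∀ x y : α × β, x.1 = y.1 → x.2 ≠ y.2 → w s(x, y) = ω₂)
    {A B C : ℂ}
    (hA : ∀ x y : α × β, x.1 ≠ y.1 → x.2 = y.2 → f (Pi.single x 1 + Pi.single y 1) = A)
    (hB : ∀ x y : α × β, x.1 = y.1 → x.2 ≠ y.2 → f (Pi.single x 1 + Pi.single y 1) = B)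
    (hC : ∀ x y : α × β, x.1 ≠ y.1 → x.2 ≠ y.2 → f (Pi.single x 1 + Pi.single y 1) = C)
    {i j : α × β} (h1 : i.1 ≠ j.1) (h2 : i.2 ≠ j.2) :
    (∑ y, if y = i ∨ y = j then 0 else
        if G.Adj i y then w s(i, y) * f (Pi.single y 1 + Pi.single j 1) else 0) =
      ω₁ * (B + ((Fintype.card α : ℂ) - 2) * C) + ω₂ * (A + ((Fintype.card β : ℂ) - 2) * C) := by
  simp_rw [ite_or_ite_adj_comm i j (fun y => f (Pi.single y 1 + Pi.single j 1))]
  rw [wrook_sum_adj hadj hw₁ hw₂ i]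
  congr 1
  · congr 1
    have h : ∀ a : α, (if a = i.1 then (0 : ℂ) else
        if ((a, i.2) = i ∨ (a, i.2) = j) then 0 else f (Pi.single (a, i.2) 1 + Pi.single j 1)) =
        if a = i.1 then 0 else if a = j.1 then B else C := by
      intro a
      by_cases ha : a = i.1
      · simp [ha]
      · have hi : ((a, i.2) : α × β) ≠ i := fun h => ha (congrArg Prod.fst h)
        have hj : ((a, i.2) : α × β) ≠ j :=
          fun h => h2 (congrArg Prod.snd h : ((a, i.2) : α × β).2 = j.2)
        rw [if_neg ha, if_neg (not_or.mpr ⟨hi, hj⟩), if_neg ha]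
        by_cases ha' : a = j.1
        · rw [if_pos ha']
          exact hB _ _ ha' h2
        · rw [if_neg ha']
          exact hC _ _ ha' h2
    simp_rw [h]
    exact sum_ite_eq_else_ite h1 B C
  · congr 1
    have h : ∀ b : β, (if b = i.2 then (0 : ℂ) else
        if ((i.1, b) = i ∨ (i.1, b) = j) then 0 else f (Pi.single (i.1, b) 1 + Pi.single j 1)) =
        if b = i.2 then 0 else if b = j.2 then A else C := by
      intro b
      by_cases hb : b = i.2
      · simp [hb]
      · have hi : ((i.1, b) : α × β) ≠ i := fun h => hb (congrArg Prod.snd h)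
        have hj : ((i.1, b) : α × β) ≠ j :=
          fun h => h1 (congrArg Prod.fst h : ((i.1, b) : α × β).1 = j.1)
        rw [if_neg hb, if_neg (not_or.mpr ⟨hi, hj⟩), if_neg hb]
        by_cases hb' : b = j.2
        · rw [if_pos hb']
          exact hA _ _ h1 hb'
        · rw [if_neg hb']
          exact hC _ _ h1 hb'
    simp_rw [h]
    exact sum_ite_eq_else_ite h2 A C

/-- **Weighted neighbour sum at a far pair, `j`-side**. [folklore] -/
theorem farPair_whopSum'
    (hadj : ∀ x y : α × β, G.Adj x y ↔ (x.1 ≠ y.1 ∧ x.2 = y.2) ∨ (x.1 = y.1 ∧ x.2 ≠ y.2))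
    (hw₁ : ∀ x y : α × β, x.1 ≠ y.1 → x.2 = y.2 → w s(x, y) = ω₁)
    (hw₂ : ∀ x y : α × β, x.1 = y.1 → x.2 ≠ y.2 → w s(x, y) = ω₂)
    {A B C : ℂ}
    (hA : ∀ x y : α × β, x.1 ≠ y.1 → x.2 = y.2 → f (Pi.single x 1 + Pi.single y 1) = A)
    (hB : ∀ x y : α × β, x.1 = y.1 → x.2 ≠ y.2 → f (Pi.single x 1 + Pi.single y 1) = B)
    (hC : ∀ x y : α × β, x.1 ≠ y.1 → x.2 ≠ y.2 → f (Pi.single x 1 + Pi.single y 1) = C)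
    {i j : α × β} (h1 : i.1 ≠ j.1) (h2 : i.2 ≠ j.2) :
    (∑ y, if y = i ∨ y = j then 0 else
        if G.Adj j y then w s(j, y) * f (Pi.single i 1 + Pi.single y 1) else 0) =
      ω₁ * (B + ((Fintype.card α : ℂ) - 2) * C) + ω₂ * (A + ((Fintype.card β : ℂ) - 2) * C) := by
  have h := farPair_whopSum (f := f) hadj hw₁ hw₂ (A := A) (B := B) (C := C)
    (fun x y hx hy => by rw [pair_comm]; exact hA y x (Ne.symm hx) hy.symm)
    (fun x y hx hy => by rw [pair_comm]; exact hB y x hx.symm (Ne.symm hy))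
    (fun x y hx hy => by rw [pair_comm]; exact hC y x (Ne.symm hx) (Ne.symm hy))
    (i := j) (j := i) (Ne.symm h1) (Ne.symm h2)
  rw [← h]
  refine Finset.sum_congr rfl fun y _ => ?_
  rw [pair_comm y i]
  by_cases hy : (y = i ∨ y = j)
  · rw [if_pos hy, if_pos hy.symm]
  · rw [if_neg hy, if_neg (show ¬ (y = j ∨ y = i) from fun h' => hy h'.symm)]

end Summit.HubbardSuperconductivity.HubbardSuperconductivity.Theorems.AnisotropyChord.TwoMagnon
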